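import Summits.ResolutionOfSingularities.ResolutionOfSingularities.Theorems.EquisingularLiftEquisingularLiftOrdinaryPointsAnyChart
import Summits.ResolutionOfSingularities.ResolutionOfSingularities.Theorems.EquisingularLiftEquisingularLiftDegreeLeTwo
import Summits.ResolutionOfSingularities.ResolutionOfSingularities.Theorems.EquisingularLiftEquisingularLiftBankedLowDimension
import Summits.ResolutionOfSingularities.ResolutionOfSingularities.Theorems.EquisingularLiftEquisingularLiftOfPrimeForms
import HarnessLib

/-!
# The route decl `EquisingularLift` (stmt-ResolutionOfSingularities-15660) RE-CUT BY NAME in its own residual currency: regular blow-up models are needed only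
# for the non-regular prime-form hypersurfaces of degree `≥ 3` whose singular points are NOT «ordinary multiple points in linearly general position»

[OURS · leafhand-res-equisingularlift-7 g1, 2026-08-31; cell `pub/decomp-res`; item stmt-…-15660] AI-produced, weaker than expert review; NOT a statement of any
manuscript; nothing here proves resolution of singularities in positive characteristic.  DEF-FREE; no `sorry`; standard axioms; ZERO named hypotheses; pure
reduction over ✓ `equisingularLift_of_primeForms` (lh5), ✓ `EL_of_blowupModel_all` (linear-centre lift), ✓ `exists_blowupModel_of_isRegular`,
✓ `QuadricELNat.blowupModel_of_range_eq_of_degree_le_two` (lh6 g3) and ✓ `blowupModel_of_ordinaryPoints_matrix₂` (this generation).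

* ★ `StrataSplit.equisingularLift_of_forall_blowupModel_off_ordinaryPoints` — `Theses.EquisingularLift.EquisingularLift` holds BY NAME as soon as every
  `(H, ι)` of the crux (`n ≥ 3`) with `H` NOT regular and `range ι = V₊(F)` for a PRIME form `F` of degree `e ≥ 3` whose singular points are NOT «finitely many
  ordinary multiple points in linearly general position» (matrix form with free charts: for every `B ∈ GL`, marking `S`, chart choice `c₀` with the (ordF) data,
  some singular point is not proportional to a marked column) has a regular blow-up model.

Honest reading: closes no registered stub; the `n ≥ 5` part of the residual is still the open problem (`stub_blowupModel_ge_five`).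
-/

set_option linter.dupNamespace false -- mandated namespace `Summit.<Summit>.<Problem>` of this single-conjunct summit

noncomputable section

open CategoryTheory CategoryTheory.Limits AlgebraicGeometry TopologicalSpace
open MvPolynomial
open Literature.AlgebraicGeometry.Resolution
open Literature.AlgebraicGeometry.Motives Literature.AlgebraicGeometry.Motives.SmoothHypersurface
open Literature.AlgebraicGeometry.Motives.ProjectiveSpace

namespace Summit.ResolutionOfSingularities.ResolutionOfSingularities.Cruxes.EquisingularLift.StrataSplit

open Summit.ResolutionOfSingularities.ResolutionOfSingularities.Cruxes.EquisingularLiftNat.Sections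

/-- ★ **`Theses.EquisingularLift.EquisingularLift` (stmt-…-15660) from regular blow-up models OFF the ordinary-points family.**  The hypothesis asks for a
regular blow-up model only of those `(H, ι)` (`n ≥ 3`, `H` not regular) cut out by a prime form `F` of degree `e ≥ 3` for which, for every invertible `B`,
duplicate-free `S` and chart choice `c₀` (`B_{c₀ c, c} = 1`) such that all marked columns are ordinary multiple points of `F` (translated charts `Φ_c + Ψ_c`,
`Φ_c` nonsingular in the closed-point sense), some singular point of `V₊(F)` is not proportional to a marked column.  Everything else — regular `H`, degree
`≤ 2`, and the ordinary-points family — is discharged in the tree in every characteristic. [OURS · lh7 g1 · DEF-FREE · pure reduction]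
[cite: Hartshorne1977, I Thm. 5.1, II Ex. 7.12] -/
theorem equisingularLift_of_forall_blowupModel_off_ordinaryPoints
    (h : ∀ p : ℕ, p.Prime → ∀ (k : Type) [Field k] [CharP k p] [IsAlgClosed k] (n : ℕ) (H : Scheme.{0})
      (ι : H ⟶ (Literature.AlgebraicGeometry.Motives.projectiveSpace n k).left), IsClosedImmersion ι → IsIntegral H →
      (∀ y : (Literature.AlgebraicGeometry.Motives.projectiveSpace n k).left,
        ∃ U : (Literature.AlgebraicGeometry.Motives.projectiveSpace n k).left.affineOpens,
          y ∈ (U : (Literature.AlgebraicGeometry.Motives.projectiveSpace n k).left.Opens) ∧ (ι.ker.ideal U).IsPrincipal) →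
      3 ≤ n → ¬ Scheme.IsRegular H → ∀ (e : ℕ) (F : MvPolynomial (Fin (n + 1)) k), 3 ≤ e → F.IsHomogeneous e → Prime F →
      (letI := MvPolynomial.gradedAlgebra (σ := Fin (n + 1)) (R := k)
       Set.range ι = {x : Proj (homogeneousSubmodule (Fin (n + 1)) k) | F ∈ x.asHomogeneousIdeal}) →
      (∀ (B : Matrix (Fin (n + 1)) (Fin (n + 1)) k) (S : List (Fin (n + 1))) (c₀ : Fin (n + 1) → Fin (n + 1)),
        IsUnit B.det → S.Nodup → (∀ c ∈ S, B (c₀ c) c = 1) →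
        (∀ c ∈ S, ∃ (μ : ℕ) (Φ Ψ : MvPolynomial (Fin n) k), 1 ≤ μ ∧ Φ.IsHomogeneous μ ∧
          (∀ z : Fin n → k, z ≠ 0 → eval z Φ = 0 → ∃ j, eval z (pderiv j Φ) ≠ 0) ∧
          Ψ ∈ Ideal.span (Set.range (X : Fin n → MvPolynomial (Fin n) k)) ^ (μ + 1) ∧
          aeval (fun j : Fin n => (X j : MvPolynomial (Fin n) k) + C (B ((c₀ c).succAbove j) c)) (ProjectiveSpace.dehomogenize k (c₀ c) F) = Φ + Ψ) →
        ∃ b : Fin (n + 1) → k, b ≠ 0 ∧ eval b F = 0 ∧ (∀ j, eval b (pderiv j F) = 0) ∧ ∀ c ∈ S, ∀ s : k, b ≠ s • fun l => B l c) →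
      ∃ 𝔞 : H.IdealSheafData, 𝔞 ≠ ⊥ ∧ ∀ (Z : Scheme.{0}) (π : Z ⟶ H), IsBlowup π 𝔞 → Scheme.IsRegular Z) :
    Summit.ResolutionOfSingularities.ResolutionOfSingularities.Theses.EquisingularLift.EquisingularLift := by
  refine equisingularLift_of_primeForms ?_
  intro p hp k _ _ _ n H ι hι hH hloc hn e F he hF hprime hrange
  haveI := hι
  haveI := hH
  refine EL_of_blowupModel_all p hp k n H ι hι hH hloc ?_
  obtain ⟨r, rfl⟩ : ∃ r, n = r + 1 + 1 := ⟨n - 2, by omega⟩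
  by_cases hreg : Scheme.IsRegular H
  · exact exists_blowupModel_of_isRegular hreg
  by_cases he2 : e ≤ 2
  · exact QuadricELNat.blowupModel_of_range_eq_of_degree_le_two ι F hF he2 hprime hrange
  have he3 : 3 ≤ e := by omega
  by_cases hex : ∃ (B : Matrix (Fin (r + 1 + 1 + 1)) (Fin (r + 1 + 1 + 1)) k) (S : List (Fin (r + 1 + 1 + 1)))
      (c₀ : Fin (r + 1 + 1 + 1) → Fin (r + 1 + 1 + 1)),
      IsUnit B.det ∧ S.Nodup ∧ (∀ c ∈ S, B (c₀ c) c = 1) ∧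
      (∀ c ∈ S, ∃ (μ : ℕ) (Φ Ψ : MvPolynomial (Fin (r + 1 + 1)) k), 1 ≤ μ ∧ Φ.IsHomogeneous μ ∧
        (∀ z : Fin (r + 1 + 1) → k, z ≠ 0 → eval z Φ = 0 → ∃ j, eval z (pderiv j Φ) ≠ 0) ∧
        Ψ ∈ Ideal.span (Set.range (X : Fin (r + 1 + 1) → MvPolynomial (Fin (r + 1 + 1)) k)) ^ (μ + 1) ∧
        aeval (fun j : Fin (r + 1 + 1) => (X j : MvPolynomial (Fin (r + 1 + 1)) k) + C (B ((c₀ c).succAbove j) c))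
          (ProjectiveSpace.dehomogenize k (c₀ c) F) = Φ + Ψ) ∧
      (∀ b : Fin (r + 1 + 1 + 1) → k, b ≠ 0 → eval b F = 0 → (∀ j, eval b (pderiv j F) = 0) → ∃ c ∈ S, ∃ s : k, b = s • fun l => B l c)
  · obtain ⟨B, S, c₀, hB, hS, hB1, hord, hjac⟩ := hex
    have hord' : ∀ c ∈ S, ∃ (μ : ℕ) (Φ Ψ : MvPolynomial (Fin (r + 2)) k), 1 ≤ μ ∧ Φ.IsHomogeneous μ ∧ IsNonsingularForm k Φ ∧
        Ψ ∈ Ideal.span (Set.range (X : Fin (r + 2) → MvPolynomial (Fin (r + 2)) k)) ^ (μ + 1) ∧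
        aeval (fun j : Fin (r + 2) => (X j : MvPolynomial (Fin (r + 2)) k) + C (B ((c₀ c).succAbove j) c)) (ProjectiveSpace.dehomogenize k (c₀ c) F) = Φ + Ψ :=
      fun c hc => by
        obtain ⟨μ, Φ, Ψ, h1, h2, h3, h4, h5⟩ := hord c hc
        exact ⟨μ, Φ, Ψ, h1, h2, isNonsingularForm_of_forall_exists_eval_pderiv_ne_zero h3, h4, h5⟩
    exact blowupModel_of_ordinaryPoints_matrix₂ ι F hF hprime hrange B hB S hS c₀ hB1 hord' hjac
  · refine h p hp k (r + 1 + 1) H ι hι hH hloc hn hreg e F he3 hF hprime hrange fun B S c₀ hB hS hB1 hord => ?_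
    by_contra hno
    refine hex ⟨B, S, c₀, hB, hS, hB1, hord, fun b hb h0 hpart => ?_⟩
    by_contra hc
    push Not at hc
    exact hno ⟨b, hb, h0, hpart, hc⟩

end Summit.ResolutionOfSingularities.ResolutionOfSingularities.Cruxes.EquisingularLift.StrataSplit

end
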